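import Literature.MathematicalPhysics.QuantumFieldTheory.Balaban1983to89.B9Thm31SitePolarisedFormY

/-!
# `Balaban1983to89.B9Thm31SiteConjugatedFormY` — T. Bałaban, *Propagators for lattice gauge theories in a background field*, Commun. Math. Phys.
# **99** (1985) 389–434 [Balaban1985BackgroundPropagators] (3.24) p. 394 ∕ Thm 3.1 (3.46) p. 398, with S. Agmon's positive-weight method [Agmon1982]:
# ★ **THE CONJUGATED FORM OF (3.24) AT def-Y's LETTERS** — for a positive site weight `ω`, the exact identity
# `⟨ωΦ, Δ′_a(U)(ω⁻¹Φ)⟩₁ = ⟨Φ, Δ′_a(U)Φ⟩₁ − (bond defects) + (block defects)` and the defect bound by the LEVEL-WEIGHTED mass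
# `Σ_z (L^{lev z})⁻²·HS(Φ z)` (file 5b of the site-coercivity set of width seat `pub-ymgap-dag-n06-w1`; the engine of (3.46)'s decay by Agmon's method)

statement-level skeleton of published theorems with citation tags; proofs where landed; nothing here is a claim about the Yang–Mills mass gap

THE PRINT.  Thm 3.1 (3.46) p. 398: *«Finally, we have the inequalities in L₂-norms ‖hG′(U)λ‖, … ≤ B₀(Lʲη)(Lʲ′η)e^{−δ₀d(y,y′)}‖h‖‖λ‖ for supp h ⊂ Δ̃(y),
y ∈ Λ_j, supp λ ⊂ Δ̃(y′)»*, `d(y,y′)` the weighted distance of [4] (2.36) (lengths in units of the local block scale); print proves (3.42)–(3.47) by a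
random-walk expansion (p. 398).  THIS FILE and its sequel replace the random walk by the positive-weight argument for the `L²` inequality (3.46a) at
def-Y's letters: file 3c's LEVEL-WEIGHTED coercivity (`trIP_deltaPrimeAY_parSymY_ge_levelMass`: `(1∕8)Σ_z(L^{lev z})⁻²HS(Φ z) ≤ ⟨Φ, Δ′_a(U)Φ⟩₁`) is a
position-dependent mass whose Agmon metric IS print's weighted distance — which is why (3.46)'s prefactor `(Lʲη)(Lʲ′η)` and its rate come out in print's
shape in the sequel.

WHAT THIS FILE PROVES (sorry-free; 0 `def`; at a `G`-valued background, `G ≤ U(N)`, on ANY inverse-symmetric `G`-valued transporter table `par` — NO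
smallness; nothing of [B9] asserted).  Notation as file 5a, plus `T_μΦ(z) := R(U_μ(z))Φ(z+e_μ)`, `ωΦ := (z ↦ ω(z)·Φ(z))`.
* §4 `cdS_wsmul_apply`, `cdS_apply_eq`, `crnTrY_wsmul`, `re_trace_cdS_wsmul_winv` (per bond: `conj = plain − q·Re tr(AᴴB)`), `re_trace_crnTrY_wsmul_winv`,
  `sum_sum_avgCoeffY_ratio_symm`, ★★ `trIP_wsmul_deltaPrimeAY_winv_eq` (THE CONJUGATION IDENTITY:
  `⟨ωΦ, Δ′_a(U)(ω⁻¹Φ)⟩₁ = ⟨Φ, Δ′_a(U)Φ⟩₁ − Σ_μΣ_z q(ω(z+e_μ), ω z)·Re tr((T_μΦ z)ᴴΦ z) + ½Σ_zΣ_w a(z,w)·q(ω z, ω w)·Re tr(X_zᴴX_w)` — the cross terms of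
  a difference square carry `−`, those of the block square `+`; both coefficients are `q ≥ 0` times an indefinite pairing).
* §5 `abs_bondDefect_le`, `abs_blockDefect_le`, ★★★ `trIP_wsmul_deltaPrimeAY_winv_ge` (THE DEFECT BOUND): if `q(ω(z+e_μ), ω z) ≤ θ_b·m_z` and
  `≤ θ_b·m_{z+e_μ}` on every bond and `q(ω z, ω w) ≤ θ_s` whenever `z, w` lie in one block of `𝔅`, then
  `⟨Φ, Δ′_a(U)Φ⟩₁ − ((d+1)θ_b + θ_s∕2)·Σ_z m_z·HS(Φ z) ≤ ⟨ωΦ, Δ′_a(U)(ω⁻¹Φ)⟩₁` (the block defect is automatically level-weighted: `Σ_w a(z,w) ≤ m_z`).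
MODEL ∕ DECLARED READINGS.  As files 3c∕4: def-Y's letters, fibre `M_N(ℂ)`, weight-`1` trace pairing; the hypotheses on `ω` are the two Lipschitz
properties of an Agmon weight `ω = e^{δρ}` (bond steps of `ρ` at most the local scale `L^{−lev}`, block oscillation of `ρ` bounded) — instantiated in the
sequel; `θ_b, θ_s` free parameters.  PRIOR ART DECLARED: pub-balaban's `B5CombesThomas*`, `T4ConstrainedAgmon`, NE9 `B9Eq3101ConjugationLetters*` are the
same device in abstract Hilbert space ∕ at that cell's one-step letters; no bridge to def-Y's multi-level letters exists, nothing of theirs is restated or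
imported.  HONEST SCOPE.  An algebraic identity and an elementary bound for one finite lattice operator; NOT a node discharge, NOT summit progress;
count-neutral; nothing continuum ∕ OS ∕ mass gap ∕ Clay.  NEW file importing file 5a only; nothing landed is modified.  Net new unproved facts: 0.
-/

noncomputable section

namespace Literature.MathematicalPhysics.QuantumFieldTheory.Balaban1983to89.B9Thm31SiteConjugatedFormY

open Literature.MathematicalPhysics.QuantumFieldTheory.Balaban1983to89
open Node00 B6KLevelCensusIndexV1 B6Geom246MultiLevelBox B6MultiLevelBoxOperator B6MultiLevelTorusOperator B6GlobalChartV1 B9BackgroundsKLevelV1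
  B9Eq39Adjoint B9Thm311ReadingCoords B9Thm311DeltaPrimePos B9Ineq369CurvatureSmallAtLettersY B9Thm31SiteCoerciveGaugeBlockY
  B9Thm31SiteCoerciveReg335Y B9Thm31SiteGpBoundsReg335Y B9Thm31SitePolarisedFormY
open Literature.MathematicalPhysics.QuantumFieldTheory.Balaban1983to89.B9Ineq349SiteAdjoint (trIP_comm)
open Literature.MathematicalPhysics.QuantumFieldTheory.Balaban1983to89.B9Thm311DeltaPrimeSymm (trIP_one_eq sum_trace_mul_lapS avgCoeffY_eq_ite avgCoeffY_symm
  cornerY_levY_eq re_trace_conjTranspose_mul_comm)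
open Literature.MathematicalPhysics.QuantumFieldTheory.Balaban1983to89.B9Thm311AdjointAtLetters (trace_conjTranspose_R_mul re_trace_conjTranspose_mul_trLiftY)
open Literature.MathematicalPhysics.QuantumFieldTheory.Balaban1983to89.B9Thm37CubeCoverCommutatorSizes (avgCoeffY_nonneg)
open scoped Matrix Matrix.Norms.L2Operator

/-! ## §4 The conjugation identity -/

section Conj

variable {d ℓ : ℕ} {hd : 1 ≤ d + 1} {hL : Odd (ℓ + 1) ∧ 1 < ℓ + 1} {b₀ b₁ : ℝ}
variable (i : KIdx d ℓ hd hL b₀ b₁) {N : ℕ} {G : Subgroup (Matrix (Fin N) (Fin N) ℂ)ˣ}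

/-- the covariant derivative of a weighted field, pointwise: `∇_{U,μ}(ωΦ)(z) = ω(z+e_μ)·R(U_μ(z))Φ(z+e_μ) − ω(z)·Φ(z)`.
[cite: Balaban1985BackgroundPropagators, (3.3) p.390; Agmon1982, Ch.1] -/
theorem cdS_wsmul_apply (U : CfgY (Matrix (Fin N) (Fin N) ℂ) i) (μ : Fin (d + 1)) (ω : SiteY i → ℝ) (Φ : SiteY i → Matrix (Fin N) (Fin N) ℂ)
    (z : SiteY i) :
    cdS i U μ (fun w => ((ω w : ℝ) : ℂ) • Φ w) z
      = ((ω (shiftY i μ z) : ℝ) : ℂ) • R (UboxY i U μ z) (Φ (shiftY i μ z)) - ((ω z : ℝ) : ℂ) • Φ z := by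
  show R (UboxY i U μ z) (((ω (shiftY i μ z) : ℝ) : ℂ) • Φ (shiftY i μ z)) - ((ω z : ℝ) : ℂ) • Φ z = _
  rw [R_smul]

/-- the plain covariant derivative, pointwise, in the same shape. [cite: Balaban1985BackgroundPropagators, (3.3) p.390, bookkeeping] -/
theorem cdS_apply_eq (U : CfgY (Matrix (Fin N) (Fin N) ℂ) i) (μ : Fin (d + 1)) (Φ : SiteY i → Matrix (Fin N) (Fin N) ℂ) (z : SiteY i) :
    cdS i U μ Φ z = ((1 : ℝ) : ℂ) • R (UboxY i U μ z) (Φ (shiftY i μ z)) - ((1 : ℝ) : ℂ) • Φ z := by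
  rw [Complex.ofReal_one, one_smul, one_smul]; rfl

/-- the corner-frame reading of a weighted field: `X^{ωΦ}_z = ω(z)·X^Φ_z`. [cite: Balaban1985BackgroundPropagators, (3.19) p.393, bookkeeping] -/
theorem crnTrY_wsmul (par : SiteParY (Matrix (Fin N) (Fin N) ℂ) i) (U : CfgY (Matrix (Fin N) (Fin N) ℂ) i) (ω : SiteY i → ℝ)
    (Φ : SiteY i → Matrix (Fin N) (Fin N) ℂ) (z : SiteY i) :
    crnTrY i par U (fun w => ((ω w : ℝ) : ℂ) • Φ w) z = ((ω z : ℝ) : ℂ) • crnTrY i par U Φ z := by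
  simp only [crnTrY, R_smul]

/-- the gradient pairing of the conjugated pair, per bond: with `A = R(U_μ(z))Φ(z+e_μ)`, `B = Φ(z)`, `s = ω(z+e_μ)`, `t = ω(z)`:
`Re tr((∇(ωΦ))(z)ᴴ(∇(ω⁻¹Φ))(z)) = Re tr((∇Φ)(z)ᴴ(∇Φ)(z)) − q(s,t)·Re tr(AᴴB)`. [cite: Agmon1982, Ch.1; Balaban1985BackgroundPropagators, (3.23) p.394] -/
theorem re_trace_cdS_wsmul_winv (U : CfgY (Matrix (Fin N) (Fin N) ℂ) i) (μ : Fin (d + 1)) {ω : SiteY i → ℝ} (hω : ∀ z, 0 < ω z)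
    (Φ : SiteY i → Matrix (Fin N) (Fin N) ℂ) (z : SiteY i) :
    (Matrix.trace ((cdS i U μ (fun w => ((ω w : ℝ) : ℂ) • Φ w) z)ᴴ * cdS i U μ (fun w => (((ω w)⁻¹ : ℝ) : ℂ) • Φ w) z)).re
      = (Matrix.trace ((cdS i U μ Φ z)ᴴ * cdS i U μ Φ z)).re
        - (ω (shiftY i μ z) / ω z + ω z / ω (shiftY i μ z) - 2) *
            (Matrix.trace ((R (UboxY i U μ z) (Φ (shiftY i μ z)))ᴴ * Φ z)).re := by
  rw [cdS_wsmul_apply, cdS_wsmul_apply, cdS_apply_eq i U μ Φ z, re_trace_smul_sub_smul, re_trace_smul_sub_smul]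
  have hs : ω (shiftY i μ z) ≠ 0 := (hω _).ne'
  have ht : ω z ≠ 0 := (hω _).ne'
  field_simp
  ring

/-- the block pairing of the conjugated pair, per pair of sites: `a(z,w)·Re tr((X^{ωΦ}_z)ᴴ X^{ω⁻¹Φ}_w) = a(z,w)·(ω z∕ω w)·Re tr(X_zᴴ X_w)`.
[cite: Agmon1982, Ch.1; Balaban1985BackgroundPropagators, (3.24) p.394] -/
theorem re_trace_crnTrY_wsmul_winv (par : SiteParY (Matrix (Fin N) (Fin N) ℂ) i) (U : CfgY (Matrix (Fin N) (Fin N) ℂ) i) (ω : SiteY i → ℝ)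
    (Φ : SiteY i → Matrix (Fin N) (Fin N) ℂ) (z w : SiteY i) :
    (Matrix.trace ((crnTrY i par U (fun v => ((ω v : ℝ) : ℂ) • Φ v) z)ᴴ * crnTrY i par U (fun v => (((ω v)⁻¹ : ℝ) : ℂ) • Φ v) w)).re
      = ω z * (ω w)⁻¹ * (Matrix.trace ((crnTrY i par U Φ z)ᴴ * crnTrY i par U Φ w)).re := by
  rw [crnTrY_wsmul, crnTrY_wsmul, re_trace_ofReal_smul_left, re_trace_ofReal_smul_right, mul_assoc]

/-- THE SYMMETRISATION OF THE BLOCK SUM: `Σ_zΣ_w a(z,w)·(ω z∕ω w)·T(z,w) = Σ_zΣ_w a(z,w)·(ω w∕ω z)·T(z,w)` for the symmetric kernels `a` and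
`T(z,w) = Re tr(X_zᴴX_w)`. [cite: Agmon1982, Ch.1, bookkeeping] -/
theorem sum_sum_avgCoeffY_ratio_symm (par : SiteParY (Matrix (Fin N) (Fin N) ℂ) i) (U : CfgY (Matrix (Fin N) (Fin N) ℂ) i) (ω : SiteY i → ℝ)
    (Φ : SiteY i → Matrix (Fin N) (Fin N) ℂ) :
    ∑ z, ∑ w, avgCoeffY i z w * (ω z * (ω w)⁻¹ * (Matrix.trace ((crnTrY i par U Φ z)ᴴ * crnTrY i par U Φ w)).re)
      = ∑ z, ∑ w, avgCoeffY i z w * (ω w * (ω z)⁻¹ * (Matrix.trace ((crnTrY i par U Φ z)ᴴ * crnTrY i par U Φ w)).re) := by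
  rw [Finset.sum_comm]
  refine Finset.sum_congr rfl fun z _ => Finset.sum_congr rfl fun w _ => ?_
  rw [avgCoeffY_symm i w z, re_trace_conjTranspose_mul_comm (crnTrY i par U Φ z) (crnTrY i par U Φ w)]

/-- ★★ **THE CONJUGATION IDENTITY FOR (3.24) AT def-Y's LETTER** (any inverse-symmetric `G`-valued table, `G`-valued `U`, `G ≤ U(N)`, `ω > 0`):
`⟨ωΦ, Δ′_a(U)(ω⁻¹Φ)⟩₁ = ⟨Φ, Δ′_a(U)Φ⟩₁ − Σ_μΣ_z q(ω(z+e_μ), ω z)·Re tr((R(U_μ(z))Φ(z+e_μ))ᴴΦ(z)) + ½·Σ_zΣ_w a(z,w)·q(ω z, ω w)·Re tr(X_zᴴX_w)`.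
[cite: Agmon1982, Ch.1 (e^{δρ}He^{−δρ}); Balaban1985BackgroundPropagators, (3.24) p.394, Thm 3.1 (3.46) p.398] -/
theorem trIP_wsmul_deltaPrimeAY_winv_eq (hG : G ≤ B7Prop2Explicit.unitaryUnits (Matrix (Fin N) (Fin N) ℂ))
    (par : SiteParY (Matrix (Fin N) (Fin N) ℂ) i) (U : CfgY (Matrix (Fin N) (Fin N) ℂ) i) (hinv : ∀ z z' : SiteY i, par U z z' = (par U z' z)⁻¹)
    (hpar : ∀ z w : SiteY i, par U z w ∈ G) (hU : ∀ μ x, U μ x ∈ G) {ω : SiteY i → ℝ} (hω : ∀ z, 0 < ω z) (Φ : SiteY i → Matrix (Fin N) (Fin N) ℂ) :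
    trIP (fun _ => (1 : ℝ)) (fun z => ((ω z : ℝ) : ℂ) • Φ z) (deltaPrimeAY i par U (fun z => (((ω z)⁻¹ : ℝ) : ℂ) • Φ z))
      = trIP (fun _ => (1 : ℝ)) Φ (deltaPrimeAY i par U Φ)
        - ∑ μ : Fin (d + 1), ∑ z, (ω (shiftY i μ z) / ω z + ω z / ω (shiftY i μ z) - 2) *
            (Matrix.trace ((R (UboxY i U μ z) (Φ (shiftY i μ z)))ᴴ * Φ z)).re
        + (1 / 2 : ℝ) * ∑ z, ∑ w, avgCoeffY i z w * ((ω z / ω w + ω w / ω z - 2) * (Matrix.trace ((crnTrY i par U Φ z)ᴴ * crnTrY i par U Φ w)).re) := by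
  rw [trIP_deltaPrimeAY_bilin i hG par U hinv hpar hU, trIP_deltaPrimeAY_bilin i hG par U hinv hpar hU]
  -- gradient part, bond by bond
  have hgrad : ∀ μ : Fin (d + 1),
      trIP (fun _ => (1 : ℝ)) (cdS i U μ (fun z => ((ω z : ℝ) : ℂ) • Φ z)) (cdS i U μ (fun z => (((ω z)⁻¹ : ℝ) : ℂ) • Φ z))
        = trIP (fun _ => (1 : ℝ)) (cdS i U μ Φ) (cdS i U μ Φ)
          - ∑ z, (ω (shiftY i μ z) / ω z + ω z / ω (shiftY i μ z) - 2) * (Matrix.trace ((R (UboxY i U μ z) (Φ (shiftY i μ z)))ᴴ * Φ z)).re := by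
    intro μ
    rw [trIP_one_eq, trIP_one_eq, Complex.re_sum, Complex.re_sum, ← Finset.sum_sub_distrib]
    exact Finset.sum_congr rfl fun z _ => re_trace_cdS_wsmul_winv i U μ hω Φ z
  -- block part, pair by pair, then symmetrise
  have hblk : ∑ z, ∑ w, avgCoeffY i z w *
        (Matrix.trace ((crnTrY i par U (fun v => ((ω v : ℝ) : ℂ) • Φ v) z)ᴴ * crnTrY i par U (fun v => (((ω v)⁻¹ : ℝ) : ℂ) • Φ v) w)).re
      = ∑ z, ∑ w, avgCoeffY i z w * (ω z * (ω w)⁻¹ * (Matrix.trace ((crnTrY i par U Φ z)ᴴ * crnTrY i par U Φ w)).re) := by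
    refine Finset.sum_congr rfl fun z _ => Finset.sum_congr rfl fun w _ => ?_
    rw [re_trace_crnTrY_wsmul_winv]
  have hsymm := sum_sum_avgCoeffY_ratio_symm i par U ω Φ
  rw [Finset.sum_congr rfl fun μ _ => hgrad μ, Finset.sum_sub_distrib, hblk]
  -- `S + S′ = 2·S₀ + S_q` pair by pair (`S′` the swapped sum, `S₀` the plain block form), and `S = S′`
  have e2 : ∑ z, ∑ w, avgCoeffY i z w * (ω z * (ω w)⁻¹ * (Matrix.trace ((crnTrY i par U Φ z)ᴴ * crnTrY i par U Φ w)).re)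
        + ∑ z, ∑ w, avgCoeffY i z w * (ω w * (ω z)⁻¹ * (Matrix.trace ((crnTrY i par U Φ z)ᴴ * crnTrY i par U Φ w)).re)
      = 2 * ∑ z, ∑ w, avgCoeffY i z w * (Matrix.trace ((crnTrY i par U Φ z)ᴴ * crnTrY i par U Φ w)).re
        + ∑ z, ∑ w, avgCoeffY i z w * ((ω z / ω w + ω w / ω z - 2) * (Matrix.trace ((crnTrY i par U Φ z)ᴴ * crnTrY i par U Φ w)).re) := by
    rw [Finset.mul_sum, ← Finset.sum_add_distrib, ← Finset.sum_add_distrib]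
    refine Finset.sum_congr rfl fun z _ => ?_
    rw [Finset.mul_sum, ← Finset.sum_add_distrib, ← Finset.sum_add_distrib]
    refine Finset.sum_congr rfl fun w _ => ?_
    simp only [div_eq_mul_inv]
    ring
  linear_combination (1 / 2 : ℝ) * e2 + (1 / 2 : ℝ) * hsymm

end Conj

/-! ## §5 The defect bound by the level-weighted mass -/

section Bound

variable {d ℓ : ℕ} {hd : 1 ≤ d + 1} {hL : Odd (ℓ + 1) ∧ 1 < ℓ + 1} {b₀ b₁ : ℝ}
variable (i : KIdx d ℓ hd hL b₀ b₁) {N : ℕ} {G : Subgroup (Matrix (Fin N) (Fin N) ℂ)ˣ}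

/-- THE BOND DEFECTS ARE BOUNDED BY THE MASS: if `0 ≤ q_μ(z) ≤ θ_b·m_z` and `q_μ(z) ≤ θ_b·m_{z+e_μ}` then
`|Σ_μΣ_z q_μ(z)·Re tr((R(U_μ(z))Φ(z+e_μ))ᴴΦ(z))| ≤ (d+1)·θ_b·Σ_z m_z·HS(Φ z)` (`G`-valued `U`, `G ≤ U(N)`).
[cite: Agmon1982, Ch.1; Balaban1985BackgroundPropagators, (3.23) p.394] -/
theorem abs_bondDefect_le (hG : G ≤ B7Prop2Explicit.unitaryUnits (Matrix (Fin N) (Fin N) ℂ)) {U : CfgY (Matrix (Fin N) (Fin N) ℂ) i}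
    (hU : ∀ μ x, U μ x ∈ G) {ω : SiteY i → ℝ} (hω : ∀ z, 0 < ω z) {θb : ℝ}
    (hb1 : ∀ μ z, ω (shiftY i μ z) / ω z + ω z / ω (shiftY i μ z) - 2 ≤ θb * (((((ℓ + 1) ^ (blkOf i.D.toDomains z).1.1 : ℕ) : ℝ)) ^ 2)⁻¹)
    (hb2 : ∀ μ z, ω (shiftY i μ z) / ω z + ω z / ω (shiftY i μ z) - 2 ≤ θb * (((((ℓ + 1) ^ (blkOf i.D.toDomains (shiftY i μ z)).1.1 : ℕ) : ℝ)) ^ 2)⁻¹)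
    (Φ : SiteY i → Matrix (Fin N) (Fin N) ℂ) :
    |∑ μ : Fin (d + 1), ∑ z, (ω (shiftY i μ z) / ω z + ω z / ω (shiftY i μ z) - 2) * (Matrix.trace ((R (UboxY i U μ z) (Φ (shiftY i μ z)))ᴴ * Φ z)).re|
      ≤ ((d : ℝ) + 1) * θb * ∑ z : SiteY i, (((((ℓ + 1) ^ (blkOf i.D.toDomains z).1.1 : ℕ) : ℝ)) ^ 2)⁻¹ * ∑ a, ∑ b, ‖Φ z a b‖ ^ 2 := by
  set m : SiteY i → ℝ := fun z => (((((ℓ + 1) ^ (blkOf i.D.toDomains z).1.1 : ℕ) : ℝ)) ^ 2)⁻¹ with hm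
  have hper : ∀ μ : Fin (d + 1),
      |∑ z, (ω (shiftY i μ z) / ω z + ω z / ω (shiftY i μ z) - 2) * (Matrix.trace ((R (UboxY i U μ z) (Φ (shiftY i μ z)))ᴴ * Φ z)).re|
        ≤ θb * ∑ z, m z * ∑ a, ∑ b, ‖Φ z a b‖ ^ 2 := by
    intro μ
    refine (Finset.abs_sum_le_sum_abs _ _).trans ?_
    have hz : ∀ z, |(ω (shiftY i μ z) / ω z + ω z / ω (shiftY i μ z) - 2) * (Matrix.trace ((R (UboxY i U μ z) (Φ (shiftY i μ z)))ᴴ * Φ z)).re|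
        ≤ (1 / 2 : ℝ) * (θb * m (shiftY i μ z) * ∑ a, ∑ b, ‖Φ (shiftY i μ z) a b‖ ^ 2) + (1 / 2 : ℝ) * (θb * m z * ∑ a, ∑ b, ‖Φ z a b‖ ^ 2) := by
      intro z
      have hq0 : 0 ≤ ω (shiftY i μ z) / ω z + ω z / ω (shiftY i μ z) - 2 := q_nonneg (hω _) (hω _)
      rw [abs_mul, abs_of_nonneg hq0]
      have h1 := abs_re_trace_le_half_add (R (UboxY i U μ z) (Φ (shiftY i μ z))) (Φ z)
      have h2 := hs_R_le (contractive_of_mem_unitary (V := UboxY i U μ z) (hG (hU μ _))) (Φ (shiftY i μ z))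
      have hA := hs_nonneg (Φ (shiftY i μ z))
      have hB := hs_nonneg (Φ z)
      calc (ω (shiftY i μ z) / ω z + ω z / ω (shiftY i μ z) - 2) * |(Matrix.trace ((R (UboxY i U μ z) (Φ (shiftY i μ z)))ᴴ * Φ z)).re|
          ≤ (ω (shiftY i μ z) / ω z + ω z / ω (shiftY i μ z) - 2) * ((1 / 2 : ℝ) * (∑ a, ∑ b, ‖Φ (shiftY i μ z) a b‖ ^ 2 + ∑ a, ∑ b, ‖Φ z a b‖ ^ 2)) :=
            mul_le_mul_of_nonneg_left (h1.trans (by linarith)) hq0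
        _ = (1 / 2 : ℝ) * ((ω (shiftY i μ z) / ω z + ω z / ω (shiftY i μ z) - 2) * ∑ a, ∑ b, ‖Φ (shiftY i μ z) a b‖ ^ 2)
            + (1 / 2 : ℝ) * ((ω (shiftY i μ z) / ω z + ω z / ω (shiftY i μ z) - 2) * ∑ a, ∑ b, ‖Φ z a b‖ ^ 2) := by ring
        _ ≤ (1 / 2 : ℝ) * (θb * m (shiftY i μ z) * ∑ a, ∑ b, ‖Φ (shiftY i μ z) a b‖ ^ 2) + (1 / 2 : ℝ) * (θb * m z * ∑ a, ∑ b, ‖Φ z a b‖ ^ 2) :=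
            add_le_add (mul_le_mul_of_nonneg_left (mul_le_mul_of_nonneg_right (hb2 μ z) hA) (by norm_num))
              (mul_le_mul_of_nonneg_left (mul_le_mul_of_nonneg_right (hb1 μ z) hB) (by norm_num))
    have hshift : ∑ z, θb * m (shiftY i μ z) * ∑ a, ∑ b, ‖Φ (shiftY i μ z) a b‖ ^ 2 = ∑ z, θb * m z * ∑ a, ∑ b, ‖Φ z a b‖ ^ 2 :=
      Equiv.sum_comp (shiftY i μ) (fun z => θb * m z * ∑ a, ∑ b, ‖Φ z a b‖ ^ 2)
    have hassoc : ∑ z, θb * m z * ∑ a, ∑ b, ‖Φ z a b‖ ^ 2 = θb * ∑ z, m z * ∑ a, ∑ b, ‖Φ z a b‖ ^ 2 := by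
      rw [Finset.mul_sum]; exact Finset.sum_congr rfl fun z _ => by ring
    refine (Finset.sum_le_sum fun z _ => hz z).trans (le_of_eq ?_)
    rw [Finset.sum_add_distrib, ← Finset.mul_sum, ← Finset.mul_sum, hshift, hassoc]
    ring
  calc |∑ μ : Fin (d + 1), ∑ z, (ω (shiftY i μ z) / ω z + ω z / ω (shiftY i μ z) - 2) * (Matrix.trace ((R (UboxY i U μ z) (Φ (shiftY i μ z)))ᴴ * Φ z)).re|
      ≤ ∑ μ : Fin (d + 1), |∑ z, (ω (shiftY i μ z) / ω z + ω z / ω (shiftY i μ z) - 2) * (Matrix.trace ((R (UboxY i U μ z) (Φ (shiftY i μ z)))ᴴ * Φ z)).re| :=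
        Finset.abs_sum_le_sum_abs _ _
    _ ≤ ∑ _μ : Fin (d + 1), θb * ∑ z, m z * ∑ a, ∑ b, ‖Φ z a b‖ ^ 2 := Finset.sum_le_sum fun μ _ => hper μ
    _ = ((d : ℝ) + 1) * θb * ∑ z, m z * ∑ a, ∑ b, ‖Φ z a b‖ ^ 2 := by
        rw [Finset.sum_const, Finset.card_univ, Fintype.card_fin, nsmul_eq_mul]; push_cast; ring

/-- THE BLOCK DEFECTS ARE BOUNDED BY THE MASS: if `q(ω z, ω w) ≤ θ_s` whenever `z, w` lie in one block of `𝔅`, then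
`|Σ_zΣ_w a(z,w)·q(ω z, ω w)·Re tr(X_zᴴX_w)| ≤ θ_s·Σ_z m_z·HS(Φ z)` (`levC_j·|block| ≤ m`). [cite: Agmon1982, Ch.1; Balaban1985BackgroundPropagators, (3.24) p.394] -/
theorem abs_blockDefect_le (hG : G ≤ B7Prop2Explicit.unitaryUnits (Matrix (Fin N) (Fin N) ℂ))
    (par : SiteParY (Matrix (Fin N) (Fin N) ℂ) i) (U : CfgY (Matrix (Fin N) (Fin N) ℂ) i) (hpar : ∀ z w : SiteY i, par U z w ∈ G)
    {ω : SiteY i → ℝ} (hω : ∀ z, 0 < ω z) {θs : ℝ}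
    (hs : ∀ z w : SiteY i, blkOf i.D.toDomains w = blkOf i.D.toDomains z → ω z / ω w + ω w / ω z - 2 ≤ θs) (Φ : SiteY i → Matrix (Fin N) (Fin N) ℂ) :
    |∑ z, ∑ w, avgCoeffY i z w * ((ω z / ω w + ω w / ω z - 2) * (Matrix.trace ((crnTrY i par U Φ z)ᴴ * crnTrY i par U Φ w)).re)|
      ≤ θs * ∑ z : SiteY i, (((((ℓ + 1) ^ (blkOf i.D.toDomains z).1.1 : ℕ) : ℝ)) ^ 2)⁻¹ * ∑ a, ∑ b, ‖Φ z a b‖ ^ 2 := by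
  set m : SiteY i → ℝ := fun z => (((((ℓ + 1) ^ (blkOf i.D.toDomains z).1.1 : ℕ) : ℝ)) ^ 2)⁻¹ with hm
  set hsf : SiteY i → ℝ := fun z => ∑ a, ∑ b, ‖Φ z a b‖ ^ 2 with hhsf
  -- per pair: `a q |T| ≤ a q ½(HS X_z + HS X_w) ≤ a q ½(HS Φ z + HS Φ w)`
  have hpair : ∀ z w, |avgCoeffY i z w * ((ω z / ω w + ω w / ω z - 2) * (Matrix.trace ((crnTrY i par U Φ z)ᴴ * crnTrY i par U Φ w)).re)|
      ≤ (1 / 2 : ℝ) * (avgCoeffY i z w * (ω z / ω w + ω w / ω z - 2) * hsf z) + (1 / 2 : ℝ) * (avgCoeffY i z w * (ω z / ω w + ω w / ω z - 2) * hsf w) := by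
    intro z w
    have ha := avgCoeffY_nonneg i z w
    have hq0 : 0 ≤ ω z / ω w + ω w / ω z - 2 := q_nonneg (hω _) (hω _)
    rw [abs_mul, abs_mul, abs_of_nonneg ha, abs_of_nonneg hq0]
    have h1 := abs_re_trace_le_half_add (crnTrY i par U Φ z) (crnTrY i par U Φ w)
    have hz : ∑ a, ∑ b, ‖crnTrY i par U Φ z a b‖ ^ 2 ≤ hsf z :=
      hs_R_le (contractive_of_mem_unitary (V := par U (blkCornerY i (blkOf i.D.toDomains z)) z) (hG (hpar _ _))) (Φ z)
    have hw : ∑ a, ∑ b, ‖crnTrY i par U Φ w a b‖ ^ 2 ≤ hsf w :=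
      hs_R_le (contractive_of_mem_unitary (V := par U (blkCornerY i (blkOf i.D.toDomains w)) w) (hG (hpar _ _))) (Φ w)
    have haq : 0 ≤ avgCoeffY i z w * (ω z / ω w + ω w / ω z - 2) := mul_nonneg ha hq0
    calc avgCoeffY i z w * ((ω z / ω w + ω w / ω z - 2) * |(Matrix.trace ((crnTrY i par U Φ z)ᴴ * crnTrY i par U Φ w)).re|)
        = (avgCoeffY i z w * (ω z / ω w + ω w / ω z - 2)) * |(Matrix.trace ((crnTrY i par U Φ z)ᴴ * crnTrY i par U Φ w)).re| := by ring
      _ ≤ (avgCoeffY i z w * (ω z / ω w + ω w / ω z - 2)) * ((1 / 2 : ℝ) * (hsf z + hsf w)) :=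
          mul_le_mul_of_nonneg_left (h1.trans (by linarith)) haq
      _ = _ := by ring
  -- the swapped half equals the straight half (symmetric kernels)
  have hswap : ∑ z, ∑ w, (1 / 2 : ℝ) * (avgCoeffY i z w * (ω z / ω w + ω w / ω z - 2) * hsf w)
      = ∑ z, ∑ w, (1 / 2 : ℝ) * (avgCoeffY i z w * (ω z / ω w + ω w / ω z - 2) * hsf z) := by
    rw [Finset.sum_comm]
    refine Finset.sum_congr rfl fun z _ => Finset.sum_congr rfl fun w _ => ?_
    rw [avgCoeffY_symm i w z, q_comm (ω w) (ω z)]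
  -- row sums: `Σ_w a(z,w) q ≤ θ_s Σ_w a(z,w) ≤ θ_s m_z`
  have hrow : ∀ z, ∑ w, avgCoeffY i z w * (ω z / ω w + ω w / ω z - 2) ≤ θs * m z := by
    intro z
    have h1 : ∑ w, avgCoeffY i z w * (ω z / ω w + ω w / ω z - 2) ≤ ∑ w, avgCoeffY i z w * θs := by
      refine Finset.sum_le_sum fun w _ => ?_
      by_cases hzw : blkOf i.D.toDomains w = blkOf i.D.toDomains z
      · exact mul_le_mul_of_nonneg_left (hs z w hzw) (avgCoeffY_nonneg i z w)
      · rw [avgCoeffY_eq_ite, if_neg hzw, zero_mul, zero_mul]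
    have hθ : 0 ≤ θs ∨ ∑ w, avgCoeffY i z w = 0 := by
      by_cases hz : θs < 0
      · right
        -- `z` lies in its own block, so `q(ω z, ω z) = 0 ≤ θs` forces nothing; instead use the diagonal pair: `0 ≤ θs` from `hs z z rfl`
        have h0 := hs z z rfl
        have : ω z / ω z + ω z / ω z - 2 = 0 := by rw [div_self (hω z).ne']; ring
        rw [this] at h0
        exact absurd h0 (not_le.2 hz)
      · left; exact not_lt.1 hz
    rcases hθ with hθ0 | hsum0
    · rw [← Finset.sum_mul] at h1
      calc ∑ w, avgCoeffY i z w * (ω z / ω w + ω w / ω z - 2) ≤ (∑ w, avgCoeffY i z w) * θs := h1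
        _ ≤ m z * θs := mul_le_mul_of_nonneg_right (sum_avgCoeffY_le i z) hθ0
        _ = θs * m z := mul_comm _ _
    · have hall : ∀ w, avgCoeffY i z w = 0 := fun w =>
        le_antisymm (by rw [← hsum0]; exact Finset.single_le_sum (fun w _ => avgCoeffY_nonneg i z w) (Finset.mem_univ w)) (avgCoeffY_nonneg i z w)
      have h0 := hs z z rfl
      have e0 : ω z / ω z + ω z / ω z - 2 = 0 := by rw [div_self (hω z).ne']; ring
      simp only [hall, zero_mul, Finset.sum_const_zero]
      rw [e0] at h0
      exact mul_nonneg h0 (inv_nonneg.2 (by positivity))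
  calc |∑ z, ∑ w, avgCoeffY i z w * ((ω z / ω w + ω w / ω z - 2) * (Matrix.trace ((crnTrY i par U Φ z)ᴴ * crnTrY i par U Φ w)).re)|
      ≤ ∑ z, ∑ w, |avgCoeffY i z w * ((ω z / ω w + ω w / ω z - 2) * (Matrix.trace ((crnTrY i par U Φ z)ᴴ * crnTrY i par U Φ w)).re)| :=
        (Finset.abs_sum_le_sum_abs _ _).trans (Finset.sum_le_sum fun z _ => Finset.abs_sum_le_sum_abs _ _)
    _ ≤ ∑ z, ∑ w, ((1 / 2 : ℝ) * (avgCoeffY i z w * (ω z / ω w + ω w / ω z - 2) * hsf z)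
          + (1 / 2 : ℝ) * (avgCoeffY i z w * (ω z / ω w + ω w / ω z - 2) * hsf w)) :=
        Finset.sum_le_sum fun z _ => Finset.sum_le_sum fun w _ => hpair z w
    _ = ∑ z, ∑ w, avgCoeffY i z w * (ω z / ω w + ω w / ω z - 2) * hsf z := by
        simp only [Finset.sum_add_distrib]
        rw [hswap, ← Finset.sum_add_distrib]
        refine Finset.sum_congr rfl fun z _ => ?_
        rw [← Finset.sum_add_distrib]
        refine Finset.sum_congr rfl fun w _ => ?_
        ring
    _ = ∑ z, (∑ w, avgCoeffY i z w * (ω z / ω w + ω w / ω z - 2)) * hsf z := Finset.sum_congr rfl fun z _ => by rw [Finset.sum_mul]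
    _ ≤ ∑ z, θs * m z * hsf z := Finset.sum_le_sum fun z _ => mul_le_mul_of_nonneg_right (hrow z) (hs_nonneg _)
    _ = θs * ∑ z, m z * hsf z := by rw [Finset.mul_sum]; exact Finset.sum_congr rfl fun z _ => by ring

/-- ★★★ **THE DEFECT BOUND FOR THE CONJUGATED FORM OF (3.24)** (any inverse-symmetric `G`-valued table, `G`-valued `U`, `G ≤ U(N)`, NO smallness): for a
site weight `ω > 0` whose bond ratios satisfy `q(ω(z+e_μ), ω z) ≤ θ_b·(L^{lev})⁻²` at both ends of every bond and whose block oscillation satisfies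
`q(ω z, ω w) ≤ θ_s` on every block of `𝔅`:
`⟨Φ, Δ′_a(U)Φ⟩₁ − ((d+1)θ_b + θ_s∕2)·Σ_z (L^{lev z})⁻²·HS(Φ z) ≤ ⟨ωΦ, Δ′_a(U)(ω⁻¹Φ)⟩₁`.
[cite: Agmon1982, Ch.1, Thm 1.5 (positive-weight method); Balaban1985BackgroundPropagators, (3.24) p.394, Thm 3.1 (3.46) p.398] -/
theorem trIP_wsmul_deltaPrimeAY_winv_ge (hG : G ≤ B7Prop2Explicit.unitaryUnits (Matrix (Fin N) (Fin N) ℂ))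
    (par : SiteParY (Matrix (Fin N) (Fin N) ℂ) i) (U : CfgY (Matrix (Fin N) (Fin N) ℂ) i) (hinv : ∀ z z' : SiteY i, par U z z' = (par U z' z)⁻¹)
    (hpar : ∀ z w : SiteY i, par U z w ∈ G) (hU : ∀ μ x, U μ x ∈ G) {ω : SiteY i → ℝ} (hω : ∀ z, 0 < ω z) {θb θs : ℝ}
    (hb1 : ∀ μ z, ω (shiftY i μ z) / ω z + ω z / ω (shiftY i μ z) - 2 ≤ θb * (((((ℓ + 1) ^ (blkOf i.D.toDomains z).1.1 : ℕ) : ℝ)) ^ 2)⁻¹)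
    (hb2 : ∀ μ z, ω (shiftY i μ z) / ω z + ω z / ω (shiftY i μ z) - 2 ≤ θb * (((((ℓ + 1) ^ (blkOf i.D.toDomains (shiftY i μ z)).1.1 : ℕ) : ℝ)) ^ 2)⁻¹)
    (hs : ∀ z w : SiteY i, blkOf i.D.toDomains w = blkOf i.D.toDomains z → ω z / ω w + ω w / ω z - 2 ≤ θs)
    (Φ : SiteY i → Matrix (Fin N) (Fin N) ℂ) :
    trIP (fun _ => (1 : ℝ)) Φ (deltaPrimeAY i par U Φ)
        - (((d : ℝ) + 1) * θb + θs / 2) * ∑ z : SiteY i, (((((ℓ + 1) ^ (blkOf i.D.toDomains z).1.1 : ℕ) : ℝ)) ^ 2)⁻¹ * ∑ a, ∑ b, ‖Φ z a b‖ ^ 2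
      ≤ trIP (fun _ => (1 : ℝ)) (fun z => ((ω z : ℝ) : ℂ) • Φ z) (deltaPrimeAY i par U (fun z => (((ω z)⁻¹ : ℝ) : ℂ) • Φ z)) := by
  rw [trIP_wsmul_deltaPrimeAY_winv_eq i hG par U hinv hpar hU hω Φ]
  have h1 := abs_bondDefect_le i hG hU hω hb1 hb2 Φ
  have h2 := abs_blockDefect_le i hG par U hpar hω hs Φ
  have h1' := (abs_le.1 h1).2
  have h2' := (abs_le.1 h2).1
  nlinarith [h1', h2']

end Bound

end Literature.MathematicalPhysics.QuantumFieldTheory.Balaban1983to89.B9Thm31SiteConjugatedFormY
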